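import Summits.NavierStokesRegularity.NavierStokesRegularity.Theorems.FrozenSignCascadeBoundedEnvelopeContinuationOfLiouvillePM2
import Literature.Analysis.FluidPDE.OseenMildUniqueness
import Literature.Analysis.FluidPDE.NSBoundedMildSmoothing
import Literature.Analysis.FluidPDE.NSBoundedMildOseen
import Literature.Analysis.UnboundedOperators.HeatKernelHeatEquation
import HarnessLib

/-!
# Route FrozenSignCascade · crux `BoundedEnvelopeContinuation` — the open Liouville stub holds
# when the critical constant is small on SOME past `(-∞, s₀)`

Helper file for the crux item stmt-NavierStokesRegularity-10579 (`BoundedEnvelopeContinuation`,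
conjunct (B) of route `FrozenSignCascade`), line `registered` (reshape r5); lands `--supports`
that item (registered sub-goal `stub_liouvillePM2_of_smallPast`; lead c5).

**Theorem (`liouvilleMorrey_of_smallPast`).** With the universal threshold `M₀ > 0` of lead c3's
`liouvilleMorrey_small`: a bounded ancient mild solution `v` (`ν = 1`), jointly smooth and
Oseen-mild on `(-∞,0) × ℝ³`, whose slices obey the Morrey bound `∫_{B_r(y)} ‖v t‖² ≤ M₀ r` for
all radii and centres at all times `t < s₀` of SOME past `(-∞, s₀)`, `s₀ < 0`, vanishes
identically on `(-∞, 0)`. The same with the dual pseudo-measure bound of small constant on some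
past (`liouvillePM2_of_smallPast`, through `PM² ⊂ Ṁ^{2,1}`, `setIntegral_ball_norm_sq_le_of_pmDual`).
In words: a NONTRIVIAL bounded ancient mild solution — in particular any Type-I blow-up profile,
and the KNSS record-zoom limit the crux produces from an envelope-riding blow-up — has
`‖v(t)‖_{Ṁ^{2,1}} > M₀^{1/2}` (resp. `‖v(t)‖_{PM²} > ε₀`) at times `t → -∞`: it cannot EMERGE from
a critically small far past. (The open stubs (L_M) / (L_PM2) ask the same with no smallness.)

**Proof.** The time translate `w(τ) = v(τ + s₀)` is again a bounded ancient mild solution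
(`IsMildNSSolutionBetween.comp_add_right_zero`), jointly smooth and Oseen-mild on the past
(`oseenDuhamel_translate`), with the small Morrey constant at ALL negative times; by
`liouvilleMorrey_small`, `w ≡ 0`, i.e. `v ≡ 0` on `(-∞, s₀)`. Forward in time, from the zero
slice at `s₁ = s₀ - 1` the Oseen integral equation reads `v(t) = -B¹_{s₁}(v,v)(t)` on `(s₁, 0)`,
which the zero field also solves (`heatExtension_zero_fun`, `oseenDuhamel_zero_left`); bounded
solutions of the integral equation with the same free term are unique
(`oseenMild_bounded_unique`, KNSS 2009 §3–4), so `v(t) = 0` a.e., hence everywhere (continuity),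
for `s₁ < t < 0`.

References: G. Koch, N. Nadirashvili, G. Seregin, V. Šverák, Acta Math. 203 (2009) =
arXiv:0709.3599, §3 p. 6 and §4 (4.3)–(4.4); L. Caffarelli, R. Kohn, L. Nirenberg, Comm. Pure
Appl. Math. 35 (1982), Prop. 1; P. G. Lemarié-Rieusset, *The Navier–Stokes problem in the 21st
century* (2016), Thm 14.4 and §8.5.
-/

noncomputable section

set_option linter.dupNamespace false -- nested layout Summit.<S>.<Sub>, Sub = S (D-0017)

open Set MeasureTheory Filter Topology Metric Function
open scoped ENNReal FourierTransform
open Literature.Analysis Literature.Analysis.FluidPDE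

namespace Summit.NavierStokesRegularity.NavierStokesRegularity.Theorems.BoundedEnvelope

/-- **Forward uniqueness from a zero slice.** A field `v` bounded on the past, jointly smooth on
the open past and Oseen-mild there, which vanishes at a time `s₁ < 0`, vanishes at every later
negative time (uniqueness of bounded solutions of the Oseen integral equation, KNSS 2009 §3–4:
from the zero slice both `v` and `0` solve `u(t) = -B¹_{s₁}(u,u)(t)`).
[cite: KochNadirashviliSereginSverak2009, §3 p. 6 and §4 (4.3)–(4.4)] -/
theorem eq_zero_after_of_slice_eq_zero {v : ℝ → EuclideanSpace ℝ (Fin 3) → EuclideanSpace ℝ (Fin 3)}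
    (hbd : IsBoundedOn (Set.Iio 0) v)
    (hsm : ContDiffOn ℝ (⊤ : ℕ∞) (uncurry v) (Set.Iio 0 ×ˢ Set.univ))
    (hoseen : ∀ s t : ℝ, s < t → t < 0 → ∀ x,
      v t x = UnboundedOperators.heatExtension (v s) (t - s) x - oseenDuhamel 1 s v v t x)
    {s₁ : ℝ} (hzero : ∀ x, v s₁ x = 0) :
    ∀ t ∈ Set.Ioo s₁ 0, ∀ x, v t x = 0 := by
  obtain ⟨B, hB⟩ := hbd
  have hM : 0 ≤ max B 0 := le_max_right _ _
  -- the free term vanishes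
  have hvs₁ : v s₁ = fun _ => (0 : EuclideanSpace ℝ (Fin 3)) := funext hzero
  have hU : ∀ t x, UnboundedOperators.heatExtension (v s₁) (t - s₁) x = 0 := fun t x => by
    rw [hvs₁, UnboundedOperators.heatExtension_zero_fun]; rfl
  -- measurability of `v` on the slab from joint continuity
  have hcont : ContinuousOn (uncurry v) (Set.Ioo s₁ 0 ×ˢ Set.univ) :=
    hsm.continuousOn.mono (Set.prod_mono Set.Ioo_subset_Iio_self Subset.rfl)
  have hum : AEStronglyMeasurable (uncurry v)
      ((volume : Measure (ℝ × EuclideanSpace ℝ (Fin 3))).restrict (Set.Ioo s₁ 0 ×ˢ Set.univ)) :=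
    hcont.aestronglyMeasurable (measurableSet_Ioo.prod MeasurableSet.univ)
  have hzm : AEStronglyMeasurable (uncurry (0 : ℝ → EuclideanSpace ℝ (Fin 3) → EuclideanSpace ℝ (Fin 3)))
      ((volume : Measure (ℝ × EuclideanSpace ℝ (Fin 3))).restrict (Set.Ioo s₁ 0 ×ˢ Set.univ)) :=
    aestronglyMeasurable_const
  have huniq := oseenMild_bounded_unique (E := EuclideanSpace ℝ (Fin 3)) (ν := 1) (s := s₁) (T := 0)
    (u := v) (v := 0) (U := fun t x => UnboundedOperators.heatExtension (v s₁) (t - s₁) x)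
    one_pos hM hum hzm
    (fun τ hτ y => (hB τ hτ.2 y).trans (le_max_left _ _))
    (fun τ _ y => by simp [hM])
    (fun t ht => Eventually.of_forall fun x => hoseen s₁ t ht.1 ht.2 x)
    (fun t _ => Eventually.of_forall fun x => by
      simp only [oseenDuhamel_zero_left, hU, Pi.zero_apply, sub_self])
  intro t ht x
  have hae : v t =ᵐ[volume] (0 : ℝ → EuclideanSpace ℝ (Fin 3) → EuclideanSpace ℝ (Fin 3)) t :=
    huniq t ht
  have hct : Continuous (v t) :=
    hsm.continuousOn.comp_continuous (continuous_const.prodMk continuous_id)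
      fun y => ⟨ht.2, Set.mem_univ y⟩
  have heq : v t = (0 : ℝ → EuclideanSpace ℝ (Fin 3) → EuclideanSpace ℝ (Fin 3)) t :=
    (Continuous.ae_eq_iff_eq volume hct continuous_const).1 hae
  rw [heq]; rfl

/-- **(L_M) when the Morrey constant is small on SOME past** (statement and proof in the module
docstring): with the universal `M₀ > 0` of `liouvilleMorrey_small`, a bounded ancient mild
solution (`ν = 1`), jointly smooth and Oseen-mild on `(-∞,0) × ℝ³`, with
`∫_{B_r(y)} ‖v t‖² ≤ M₀ r` for all `y`, `r > 0` and all `t < s₀` (some `s₀ < 0`), vanishes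
identically. [cite: KochNadirashviliSereginSverak2009, §3–4; CaffarelliKohnNirenberg1982, Prop. 1; LemarieRieusset2016, Thm 14.4] -/
theorem liouvilleMorrey_of_smallPast : ∃ M₀ : ℝ, 0 < M₀ ∧
    ∀ v : ℝ → EuclideanSpace ℝ (Fin 3) → EuclideanSpace ℝ (Fin 3),
      IsBoundedAncientMildSolution 1 v →
      ContDiffOn ℝ (⊤ : ℕ∞) (uncurry v) (Set.Iio 0 ×ˢ Set.univ) →
      (∀ s t : ℝ, s < t → t < 0 → ∀ x,
        v t x = UnboundedOperators.heatExtension (v s) (t - s) x - oseenDuhamel 1 s v v t x) →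
      (∃ s₀ : ℝ, s₀ < 0 ∧ ∀ t < s₀, ∀ (y : EuclideanSpace ℝ (Fin 3)) (r : ℝ), 0 < r →
        ∫ x in Metric.ball y r, ‖v t x‖ ^ 2 ≤ M₀ * r) →
      ∀ t < 0, ∀ x, v t x = 0 := by
  obtain ⟨M₀, hM₀, H⟩ := liouvilleMorrey_small
  refine ⟨M₀, hM₀, fun v hv hsm hoseen ⟨s₀, hs₀, hsmall⟩ => ?_⟩
  -- ### the time translate `w(τ) = v(τ + s₀)` is in the class, with small constant everywhere
  set w : ℝ → EuclideanSpace ℝ (Fin 3) → EuclideanSpace ℝ (Fin 3) := fun τ => v (τ + s₀) with hw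
  have hwanc : IsBoundedAncientMildSolution 1 w := by
    refine ⟨⟨fun t ht => hv.1.1 (t + s₀) (by linarith), fun s t hst ht => ?_⟩, ?_⟩
    · exact (hv.1.2 (s + s₀) (t + s₀) (by linarith) (by linarith)).comp_add_right_zero
    · obtain ⟨B, hB⟩ := hv.isBoundedOn
      exact ⟨B, fun t ht x => hB (t + s₀) (by
        simp only [Set.mem_Iio] at ht ⊢; linarith) x⟩
  have hwsm : ContDiffOn ℝ (⊤ : ℕ∞) (uncurry w) (Set.Iio 0 ×ˢ Set.univ) := by
    have hmap : ContDiff ℝ (⊤ : ℕ∞)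
        (fun p : ℝ × EuclideanSpace ℝ (Fin 3) => (p.1 + s₀, p.2)) :=
      (contDiff_fst.add contDiff_const).prodMk contDiff_snd
    have hcomp := hsm.comp (hmap.contDiffOn (s := Set.Iio 0 ×ˢ Set.univ)) (fun p hp => by
      simp only [Set.mem_prod, Set.mem_Iio, Set.mem_univ, and_true] at hp ⊢
      linarith)
    refine hcomp.congr fun p _ => ?_
    simp [hw, uncurry]
  have hwoseen : ∀ s t : ℝ, s < t → t < 0 → ∀ x,
      w t x = UnboundedOperators.heatExtension (w s) (t - s) x - oseenDuhamel 1 s w w t x := by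
    intro s t hst ht x
    have h := hoseen (s + s₀) (t + s₀) (by linarith) (by linarith) x
    rw [hw, oseenDuhamel_translate 1 s s₀ v v t x]
    simpa only [add_sub_add_right_eq_sub] using h
  have hwM : ∀ t < 0, ∀ (y : EuclideanSpace ℝ (Fin 3)) (r : ℝ), 0 < r →
      ∫ x in Metric.ball y r, ‖w t x‖ ^ 2 ≤ M₀ * r :=
    fun t ht y r hr => hsmall (t + s₀) (by linarith) y r hr
  have hw0 : ∀ t < 0, ∀ x, w t x = 0 := H w hwanc hwsm hwoseen hwM
  -- ### hence `v ≡ 0` on `(-∞, s₀)` …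
  have hpast : ∀ t < s₀, ∀ x, v t x = 0 := fun t ht x => by
    have h := hw0 (t - s₀) (by linarith) x
    simpa [hw] using h
  -- ### … and forward from the zero slice at `s₀ - 1`
  intro t ht x
  by_cases hts : t < s₀
  · exact hpast t hts x
  · have hts' : s₀ ≤ t := not_lt.1 hts
    exact eq_zero_after_of_slice_eq_zero hv.isBoundedOn hsm hoseen
      (hpast (s₀ - 1) (by linarith)) t ⟨by linarith, ht⟩ x

/-- **(L_PM2) when the pseudo-measure constant is small on SOME past**: with a universal
`ε₀ > 0`, a bounded ancient mild solution (`ν = 1`), jointly smooth and Oseen-mild on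
`(-∞,0) × ℝ³`, whose slices obey the dual `PM²` bound with constant `ε₀` at all times `t < s₀`
of some past, vanishes identically — a nontrivial solution of the class of the open stub
`stub_liouvillePM2` is, on no past `(-∞, s₀)`, uniformly `ε₀`-small in `PM²`. [cite: KochNadirashviliSereginSverak2009, §3–4; LemarieRieusset2016, §8.5 and Thm 14.4] -/
theorem liouvillePM2_of_smallPast : ∃ ε₀ : ℝ, 0 < ε₀ ∧
    ∀ v : ℝ → EuclideanSpace ℝ (Fin 3) → EuclideanSpace ℝ (Fin 3),
      IsBoundedAncientMildSolution 1 v →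
      ContDiffOn ℝ (⊤ : ℕ∞) (uncurry v) (Set.Iio 0 ×ˢ Set.univ) →
      (∀ s t : ℝ, s < t → t < 0 → ∀ x,
        v t x = UnboundedOperators.heatExtension (v s) (t - s) x - oseenDuhamel 1 s v v t x) →
      (∃ s₀ : ℝ, s₀ < 0 ∧ ∀ t < s₀, ∀ (l : Fin 3) (φ : EuclideanSpace ℝ (Fin 3) → ℝ), Integrable φ →
        Integrable (fun ξ : EuclideanSpace ℝ (Fin 3) => ‖𝓕 (fun x => (φ x : ℂ)) ξ‖ / ‖ξ‖ ^ 2) →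
        |∫ y, v t y l * φ y| ≤
          ε₀ * ∫ ξ : EuclideanSpace ℝ (Fin 3), ‖𝓕 (fun x => (φ x : ℂ)) ξ‖ / ‖ξ‖ ^ 2) →
      ∀ t < 0, ∀ x, v t x = 0 := by
  obtain ⟨M₀, hM₀, H⟩ := liouvilleMorrey_of_smallPast
  obtain ⟨κ, hκ⟩ : ∃ κ : ℝ, κ = 54 * (volume (ball (0 : EuclideanSpace ℝ (Fin 3)) 1)).toReal ^ 3 +
      18 * (volume (ball (0 : EuclideanSpace ℝ (Fin 3)) 1)).toReal := ⟨_, rfl⟩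
  have hκ0 : 0 ≤ κ := by rw [hκ]; positivity
  refine ⟨Real.sqrt (M₀ / (κ + 1)), Real.sqrt_pos.2 (div_pos hM₀ (by linarith)), ?_⟩
  rintro v hv hsm hoseen ⟨s₀, hs₀, hPM⟩
  have hε0 : 0 ≤ Real.sqrt (M₀ / (κ + 1)) := Real.sqrt_nonneg _
  have hε2 : Real.sqrt (M₀ / (κ + 1)) ^ 2 = M₀ / (κ + 1) :=
    Real.sq_sqrt (div_nonneg hM₀.le (by linarith))
  have hκε : κ * Real.sqrt (M₀ / (κ + 1)) ^ 2 ≤ M₀ := by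
    rw [hε2, mul_div_assoc']
    rw [div_le_iff₀ (by linarith : (0:ℝ) < κ + 1)]
    nlinarith
  obtain ⟨B, hB⟩ := hv.isBoundedOn
  have hcont : ∀ t < 0, Continuous (v t) := fun t ht =>
    hsm.continuousOn.comp_continuous (continuous_const.prodMk continuous_id)
      fun x => ⟨ht, Set.mem_univ x⟩
  refine H v hv hsm hoseen ⟨s₀, hs₀, fun t ht y r hr => ?_⟩
  have ht0 : t < 0 := ht.trans hs₀
  have h := setIntegral_ball_norm_sq_le_of_pmDual hε0 (hcont t ht0).aestronglyMeasurable
    (fun x => hB t ht0 x) (hPM t ht) y hr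
  rw [← hκ] at h
  calc ∫ x in Metric.ball y r, ‖v t x‖ ^ 2 ≤ κ * Real.sqrt (M₀ / (κ + 1)) ^ 2 * r := h
    _ ≤ M₀ * r := mul_le_mul_of_nonneg_right hκε hr.le

/-- **Registered sub-goal `stub_liouvillePM2_of_smallPast`** (closed form of
`liouvillePM2_of_smallPast`): the open stub (L_PM2) holds for solutions whose dual `PM²` bound has
a universally small constant on some past `(-∞, s₀)`.
[cite: KochNadirashviliSereginSverak2009, §3–4; LemarieRieusset2016, §8.5 and Thm 14.4] -/
theorem stub_liouvillePM2_of_smallPast : ∃ ε₀ : ℝ, 0 < ε₀ ∧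
    ∀ v : ℝ → EuclideanSpace ℝ (Fin 3) → EuclideanSpace ℝ (Fin 3),
      Literature.Analysis.FluidPDE.IsBoundedAncientMildSolution 1 v →
      ContDiffOn ℝ (⊤ : ℕ∞) (Function.uncurry v) (Set.Iio 0 ×ˢ Set.univ) →
      (∀ s t : ℝ, s < t → t < 0 → ∀ x,
        v t x = UnboundedOperators.heatExtension (v s) (t - s) x -
          Literature.Analysis.FluidPDE.oseenDuhamel 1 s v v t x) →
      (∃ s₀ : ℝ, s₀ < 0 ∧ ∀ t < s₀, ∀ (l : Fin 3) (φ : EuclideanSpace ℝ (Fin 3) → ℝ),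
        MeasureTheory.Integrable φ →
        MeasureTheory.Integrable (fun ξ : EuclideanSpace ℝ (Fin 3) =>
          ‖FourierTransform.fourier (fun x => (φ x : ℂ)) ξ‖ / ‖ξ‖ ^ 2) →
        |∫ y, v t y l * φ y| ≤
          ε₀ * ∫ ξ : EuclideanSpace ℝ (Fin 3), ‖FourierTransform.fourier (fun x => (φ x : ℂ)) ξ‖ / ‖ξ‖ ^ 2) →
      ∀ t < 0, ∀ x, v t x = 0 :=
  liouvillePM2_of_smallPast

end Summit.NavierStokesRegularity.NavierStokesRegularity.Theorems.BoundedEnvelope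

end
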